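import Summits.ABC.ABC.Theses.DefiniteXi
import Summits.ABC.ABC.Theorems.DefiniteXiDefiniteRTControlPrimeSmulTransportDeg
import Summits.ABC.ABC.Theorems.DefiniteXiDefiniteRTControlPrimeFreyScale
import Summits.ABC.Analytic.RequirementsSharp
import HarnessLib

/-!
# Stub ideas k1 · GEN 4 — `stub_primeToSixDegreeBound` (crux `DefiniteXi.SteinbergCore`, stmt-ABC-15024)

HOME FAMILY 1 (recognise & import), gen-4 delta: CROSS-CELL TREE MATCH against the abc-an requirements
table `Summits/ABC/Analytic/Requirements*.lean` (rows R1♯ `DegreeConjectureRat`, R4♯ `SharpCongruenceNumberRat`,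
R5♯ `HeightConjectureRat`, R9 `MurtyPastenConj44`).  Every row that implies the stub is recorded here as a typed
arrow `row → P6`; H1 is the only non-glue step (minimal-model transport, one prover cycle, pattern of
`Theorems/DefiniteXiDefiniteRTControlPrime.lean` ll. 160–215).  Verdict: each row is abc-strength (the cell's own
labels «RESTATEMENT of abc strength»), so Family 1 imports nothing short of abc — promote-stub concurred.
-/

set_option linter.dupNamespace false

noncomputable section

open scoped MatrixGroups ModularForm

namespace Summit.ABC.ABC.Cruxes.SteinbergCore.StubIdeas1G4

open Literature.NumberTheory.EllipticCurves Literature.NumberTheory.EllipticCurves.ModularForms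
open WeierstrassCurve
open Summit.ABC.Analytic Summit.ABC.ABC.Theses.DefiniteXi

/-- The stub, verbatim (`P6` = prime-to-6 part of the minimal modular degree is `≪ N^{2+ε}`). -/
def P6 : Prop :=
  ∀ ε : ℝ, 0 < ε → ∃ C : ℝ, ∀ a b : ℤ, IsCoprime a b → a * b * (a + b) ≠ 0 → ∀ (N : ℕ) [NeZero N],
    (Literature.NumberTheory.EllipticCurves.freyCurve a b).conductorNorm ℤ = N →
    ∀ D : Literature.NumberTheory.EllipticCurves.ModularForms.ModularParametrizationData
      (Literature.NumberTheory.EllipticCurves.freyCurve a b) N,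
      (∀ D' : Literature.NumberTheory.EllipticCurves.ModularForms.ModularParametrizationData
        (Literature.NumberTheory.EllipticCurves.freyCurve a b) N, D.deg ≤ D'.deg) →
      ((D.deg / (ordProj[2] D.deg * ordProj[3] D.deg) : ℕ) : ℝ) ≤ C * (N : ℝ) ^ (2 + ε)

/-- Sanity: `P6` is literally the registered stub signature. -/
example : P6 ↔ (∀ ε : ℝ, 0 < ε → ∃ C : ℝ, ∀ a b : ℤ, IsCoprime a b → a * b * (a + b) ≠ 0 → ∀ (N : ℕ) [NeZero N], (Literature.NumberTheory.EllipticCurves.freyCurve a b).conductorNorm ℤ = N → ∀ D : Literature.NumberTheory.EllipticCurves.ModularForms.ModularParametrizationData (Literature.NumberTheory.EllipticCurves.freyCurve a b) N, (∀ D' : Literature.NumberTheory.EllipticCurves.ModularForms.ModularParametrizationData (Literature.NumberTheory.EllipticCurves.freyCurve a b) N, D.deg ≤ D'.deg) → ((D.deg / (ordProj[2] D.deg * ordProj[3] D.deg) : ℕ) : ℝ) ≤ C * (N : ℝ) ^ (2 + ε)) :=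
  Iff.rfl

/-! ## H1 — the one non-glue helper: R1♯ (all `E/ℚ`, globally minimal models) ⟹ the route target on Frey curves -/

/-- **H1** `DegreeConjectureRat → FreyDegreeBound` (fact-free).  R1♯ bounds SOME datum of a globally MINIMAL model
`C • E_(a,b)` at level `N_{C•E} = N` (`conductorNorm_smul_rat`); transport it back to the Frey model with
`stub_smulTransportDeg` (`deg' = num(u)² · deg`) and `stub_freyScale` (`|num u| ≤ 2`), so `deg' ≤ 4 C₁ N^{2+ε}`.
The level is moved by generalising it to a variable and `subst` (no dependent rewriting). [folklore] -/
theorem freyDegreeBound_of_degreeConjectureRat (h : DegreeConjectureRat) : FreyDegreeBound := by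
  intro ε hε
  obtain ⟨C₁, hC₁⟩ := h ε hε
  refine ⟨4 * C₁, ?_⟩
  intro a b hab h0 N _ hN
  haveI := isElliptic_freyCurve h0
  obtain ⟨C, hC⟩ := hasGlobalMinimalModel_rat_holds (freyCurve a b)
  haveI := hC
  have hNm : (C • freyCurve a b).conductorNorm ℤ = N := by rw [conductorNorm_smul_rat, hN]
  have key : ∀ (M : ℕ) [NeZero M], (C • freyCurve a b).conductorNorm ℤ = M →
      ∃ D : ModularParametrizationData (C • freyCurve a b) M,
        (D.modularDegree : ℝ) ≤ C₁ * (M : ℝ) ^ (2 + ε) := by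
    intro M _ hM
    subst hM
    exact hC₁ (C • freyCurve a b)
  obtain ⟨D₁, hD₁⟩ := key N hNm
  obtain ⟨D', -, hdeg'⟩ :=
    Summit.ABC.ABC.Theorems.DefiniteRTControlPrime.stub_smulTransportDeg C D₁
  have hscale : (C.u : ℚ).num.natAbs ≤ 2 :=
    Summit.ABC.ABC.Theorems.DefiniteRTControlPrime.stub_freyScale a b hab h0 C hC
  refine ⟨D', ?_⟩
  have h4 : D'.deg ≤ 4 * D₁.modularDegree := by
    calc D'.deg = (C.u : ℚ).num.natAbs ^ 2 * D₁.deg := hdeg'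
      _ ≤ 2 ^ 2 * D₁.deg := Nat.mul_le_mul_right _ (Nat.pow_le_pow_left hscale 2)
      _ = 4 * D₁.modularDegree := by norm_num [ModularParametrizationData.modularDegree]
  have h4' : (D'.deg : ℝ) ≤ 4 * (D₁.modularDegree : ℝ) := by exact_mod_cast h4
  calc (D'.deg : ℝ) ≤ 4 * (D₁.modularDegree : ℝ) := h4'
    _ ≤ 4 * (C₁ * (N : ℝ) ^ (2 + ε)) := mul_le_mul_of_nonneg_left hD₁ (by norm_num)
    _ = 4 * C₁ * (N : ℝ) ^ (2 + ε) := by ring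

/-- **H1′** the weak row: `PolyModularDegreeRat K → PolyFreyDegree` (same transport; feeds stub 3 via
`Summit.ABC.ABC.Theorems.stub_abcValuationProduct_of_polyFreyDegree`, p160000 — NOT stub 2). [folklore] -/
theorem polyFreyDegree_of_polyModularDegreeRat {K : ℝ} (h : PolyModularDegreeRat K) : PolyFreyDegree := by
  obtain ⟨C₁, hC₁⟩ := h
  refine ⟨K, 4 * C₁, ?_⟩
  intro a b hab h0 N _ hN
  haveI := isElliptic_freyCurve h0
  obtain ⟨C, hC⟩ := hasGlobalMinimalModel_rat_holds (freyCurve a b)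
  haveI := hC
  have hNm : (C • freyCurve a b).conductorNorm ℤ = N := by rw [conductorNorm_smul_rat, hN]
  have key : ∀ (M : ℕ) [NeZero M], (C • freyCurve a b).conductorNorm ℤ = M →
      ∃ D : ModularParametrizationData (C • freyCurve a b) M,
        (D.modularDegree : ℝ) ≤ C₁ * (M : ℝ) ^ K := by
    intro M _ hM
    subst hM
    exact hC₁ (C • freyCurve a b)
  obtain ⟨D₁, hD₁⟩ := key N hNm
  obtain ⟨D', -, hdeg'⟩ :=
    Summit.ABC.ABC.Theorems.DefiniteRTControlPrime.stub_smulTransportDeg C D₁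
  have hscale : (C.u : ℚ).num.natAbs ≤ 2 :=
    Summit.ABC.ABC.Theorems.DefiniteRTControlPrime.stub_freyScale a b hab h0 C hC
  refine ⟨D', ?_⟩
  have h4 : D'.deg ≤ 4 * D₁.modularDegree := by
    calc D'.deg = (C.u : ℚ).num.natAbs ^ 2 * D₁.deg := hdeg'
      _ ≤ 2 ^ 2 * D₁.deg := Nat.mul_le_mul_right _ (Nat.pow_le_pow_left hscale 2)
      _ = 4 * D₁.modularDegree := by norm_num [ModularParametrizationData.modularDegree]
  have h4' : (D'.deg : ℝ) ≤ 4 * (D₁.modularDegree : ℝ) := by exact_mod_cast h4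
  calc (D'.deg : ℝ) ≤ 4 * (D₁.modularDegree : ℝ) := h4'
    _ ≤ 4 * (C₁ * (N : ℝ) ^ K) := mul_le_mul_of_nonneg_left hD₁ (by norm_num)
    _ = 4 * C₁ * (N : ℝ) ^ K := by ring

/-! ## H2–H4′ — glue: each abc-an row that reaches the stub, as a typed arrow `row → P6` -/

/-- **H2₀** the route target gives the stub: `cps(deg D_min) ≤ deg D_min ≤ deg D₀` (local copy of the tree's
`SteinbergCorePrimeRung.primeToSixDegreeBound_of_freyDegreeBound`, p162616, whose module is not in today's farm
snapshot; cite it BY NAME when landing). [folklore] -/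
theorem p6_of_freyDegreeBound (hX : FreyDegreeBound) : P6 := by
  intro ε hε
  obtain ⟨C, hC⟩ := hX ε hε
  refine ⟨C, ?_⟩
  intro a b hab h0 N _ hN D hDmin
  obtain ⟨D₀, hD₀⟩ := hC a b hab h0 N hN
  have h1 : ((D.deg / (ordProj[2] D.deg * ordProj[3] D.deg) : ℕ) : ℝ) ≤ (D.deg : ℝ) := by
    exact_mod_cast Nat.div_le_self _ _
  have h2 : (D.deg : ℝ) ≤ (D₀.deg : ℝ) := by exact_mod_cast hDmin D₀
  exact h1.trans (h2.trans hD₀)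

/-- **H2** R1♯ ⟹ P6 (= H2₀ ∘ H1; fact-free). [folklore] -/
theorem p6_of_degreeConjectureRat (h : DegreeConjectureRat) : P6 :=
  p6_of_freyDegreeBound (freyDegreeBound_of_degreeConjectureRat h)

/-- **H3** R9 (Murty–Pasten 2013 Conj. 4.4, uniform, sharp exponent) ⟹ P6, modulo modularity `hmod`, the all-curves
Mazur–Kenku degree comparison `h163` and the printed divisibility `m_f ∣ n'_f` (`hd`, MP 2013 p. 3748 — NOT in the tree).
[cite: MurtyPasten2013, Conj. 4.4 and Thm. 4.5 (p. 3748)] -/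
theorem p6_of_murtyPastenConj44 (hmod : nonempty_modularParametrizationData)
    (h163 : PastenShimura2024_minimalDegree_le_163_mul)
    (hd : ∀ (W₀ : WeierstrassCurve ℚ) [W₀.IsElliptic] (N : ℕ) [NeZero N] (D₀ : ModularParametrizationData W₀ N),
      (∀ (W' : WeierstrassCurve ℚ) [W'.IsElliptic] (D' : ModularParametrizationData W' N),
          D'.f = D₀.f → D₀.modularDegree ≤ D'.modularDegree) →
        D₀.modularDegree ∣ anemicCongruenceNumber D₀.f)
    (h : ∀ ε : ℝ, 0 < ε → ∃ C : ℝ, MurtyPastenConj44 (2 + ε) C) : P6 := by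
  refine p6_of_degreeConjectureRat fun ε hε => ?_
  obtain ⟨C, hC⟩ := h ε hε
  exact polyModularDegreeRat_of_murtyPastenConj44 hmod h163 hd hC

/-- **H4** R4♯ (sharp congruence number at square-free level) ⟹ P6 — only THROUGH abc (`abc_of_sharpCongruenceNumberRat`,
landed) and an `ABC → P6` certificate `hG3` (k1 g2 `p6_of_ABC_of_facts` / k2 `stub_of_named_facts_of_ABC`, workfiles).
Frey levels `2^e · M` with `e ≥ 2` are not square-free, so R4♯ does not reach the stub directly. [cite: AgasheRibetStein2012, Thm. 2.1] -/
theorem p6_of_sharpCongruenceNumberRat (hG3 : ABC → P6) (hmod : nonempty_modularParametrizationData)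
    (hR : modularDegree_dvd_congruenceNumber) (h163 : PastenShimura2024_minimalDegree_le_163_mul)
    (hP : murty_petersson_newform_lower_bound) (h : SharpCongruenceNumberRat) : P6 :=
  hG3 (abc_of_sharpCongruenceNumberRat hmod hR h163 hP h)

/-- **H4′** R5♯ (sharp Faltings-height conjecture) ⟹ P6 through the PROVED, hypothesis-free `abc_iff_heightConjectureRat`. -/
theorem p6_of_heightConjectureRat (hG3 : ABC → P6) (h : HeightConjectureRat) : P6 :=
  hG3 (abc_of_heightConjectureRat h)

/-- **Converse bookkeeping** (why no row is EASIER than the stub): abc ⟹ R5♯ is proved (`heightConjectureRat_of_abc`);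
abc ⟹ R1♯ only modulo `PolyManinRat 0` (`degreeConjectureRat_of_abc`, OPEN for general `E`). -/
theorem heightConjectureRat_of_abc' (habc : ABC) : HeightConjectureRat := heightConjectureRat_of_abc habc

end Summit.ABC.ABC.Cruxes.SteinbergCore.StubIdeas1G4

end
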